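import Literature.NumberTheory.QuadraticForms.MeyerRatLemmas
import Literature.NumberTheory.QuadraticForms.GlobalSquareTheorem
import HarnessLib

/-!
# Meyer's theorem: indefinite rational quadratic forms of rank `5` represent zero
# (Serre IV §3.2 Thm. 8 (iv) and Cor. 2)

Topic `NumberTheory/QuadraticForms`; namespace `Literature.NumberTheory.QuadraticForms`. Everything
here is proved.

**Meyer's theorem** (1884; Serre, *A Course in Arithmetic*, Ch. IV §3.2 Cor. 2 to Thm. 8): a
quadratic form of rank `≥ 5` over `ℚ` represents `0` iff it is indefinite. We prove it for
diagonal forms of rank `5` (`exists_quinary_zero_rat_of_indefinite`), following Serre's proof of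
the step `n = 5` of the Hasse–Minkowski theorem (Thm. 8 (iv), PDF p. 41) — the local hypotheses at
the finite places being automatic in rank `5` (Thm. 6 (iv), `exists_binary_ternary_common`):

write `f = h - g`, `h = ⟨a₀, a₁⟩`, `g = -⟨a₂, a₃, a₄⟩`; let `S` be the set of places over `2` and
the primes dividing the coefficients of `g`. For `v ∈ S` some `a_v ∈ ℚ_vˣ` is represented by `h`
and by `g` over `ℚ_v`; by the **approximation theorem** (`denseRange_algebraMap_pi_prod`,
Cassels–Fröhlich II §6) and the openness of squares (`isSquare_div_of_valued_sub_lt`) there are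
`x₀, x₁ ∈ ℚ` with `a = h(x₀, x₁)` in `a_v ℚ_vˣ²` for all `v ∈ S` and of a sign represented by `g`
over `ℝ`. The form `f₁ = aZ² - g` represents `0` in every `ℚ_v` (`v ∈ S`: `g` represents `a_v ≡ a`;
`v ∉ S`: the coefficients of `g` are units, `exists_ternary_eq_of_units`) and is indefinite, so
by the case `n = 4` (`exists_quaternary_zero_rat`) it represents `0` in `ℚ`; hence `g` represents
`a = h(x₀, x₁)` (or already represents `0`) and `f` represents `0`.

Rank `≥ 5` and the application to unimodular lattices are in the sequel.

## References

* J.-P. Serre, *A Course in Arithmetic*, GTM 7, Springer 1973, Ch. IV §3.2 Thm. 8 (iv) and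
  Cor. 2 (Meyer) (PDF p. 41); §2.2 Thm. 6 (iv); Ch. III §2.2 Lemma 2 (approximation).
  [Serre1973]
* A. Meyer, *Mathematische Mittheilungen*, Vierteljahrschrift Naturforsch. Ges. Zürich 29 (1884),
  209–222.
-/

noncomputable section

open IsDedekindDomain NumberField Rat.HeightOneSpectrum Finset Topology Filter

namespace Literature.NumberTheory.QuadraticForms

/-- The ball `{x | v(x - c) < v(4c)}` is a neighbourhood of `c ≠ 0` in `K_v`. [folklore] -/
theorem ball_four_mul_mem_nhds (v : HeightOneSpectrum (𝓞 ℚ)) {c : v.adicCompletion ℚ} (hc : c ≠ 0) :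
    {x | Valued.v (x - c) < Valued.v (4 * c)} ∈ 𝓝 c := by
  haveI : CharZero (v.adicCompletion ℚ) :=
    charZero_of_injective_algebraMap (algebraMap ℚ _).injective
  have h4 : (4 : v.adicCompletion ℚ) ≠ 0 := by norm_num
  have hne : Valued.v.restrict (4 * c) ≠ 0 := by simp [h4, hc]
  rw [Valued.mem_nhds]
  refine ⟨Units.mk0 _ hne, fun y hy ↦ ?_⟩
  rw [Set.mem_setOf_eq, Units.val_mk0] at hy
  exact Valued.v.restrict_lt_iff.mp hy

/-- **Meyer's theorem in rank `5`** (Serre, *A Course in Arithmetic*, Ch. IV §3.2 Cor. 2 to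
Thm. 8, with Thm. 8 (iv) and Thm. 6 (iv)): an indefinite diagonal quadratic form
`a₀X₀² + a₁X₁² + a₂X₂² + a₃X₃² + a₄X₄²` with `aᵢ ∈ ℚˣ` — i.e. the `aᵢ` are neither all positive nor
all negative — has a non-trivial rational zero. [cite: Serre1973, Ch. IV §3.2 Cor. 2] -/
theorem exists_quinary_zero_rat_of_indefinite {a₀ a₁ a₂ a₃ a₄ : ℚ} (h₀ : a₀ ≠ 0) (h₁ : a₁ ≠ 0)
    (h₂ : a₂ ≠ 0) (h₃ : a₃ ≠ 0) (h₄ : a₄ ≠ 0)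
    (hpos : ¬ (0 < a₀ ∧ 0 < a₁ ∧ 0 < a₂ ∧ 0 < a₃ ∧ 0 < a₄))
    (hneg : ¬ (a₀ < 0 ∧ a₁ < 0 ∧ a₂ < 0 ∧ a₃ < 0 ∧ a₄ < 0)) :
    ∃ x : Fin 5 → ℚ, x ≠ 0 ∧
      a₀ * x 0 ^ 2 + a₁ * x 1 ^ 2 + a₂ * x 2 ^ 2 + a₃ * x 3 ^ 2 + a₄ * x 4 ^ 2 = 0 := by
  classical
  -- the common sign at the real place
  obtain ⟨σ, u₀, u₁, hσ, hσh, hσg⟩ := exists_sign_binary_ternary h₀ h₁ h₂ h₃ h₄ hpos hneg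
  -- `g = ⟨-a₂, -a₃, -a₄⟩`
  have hb₂0 : -a₂ ≠ 0 := neg_ne_zero.2 h₂
  have hb₃0 : -a₃ ≠ 0 := neg_ne_zero.2 h₃
  have hb₄0 : -a₄ ≠ 0 := neg_ne_zero.2 h₄
  -- the finite set `S` of places over `2` and the primes of the coefficients of `g`
  set N : ℕ := (((-a₂).num * (-a₂).den) * ((-a₃).num * (-a₃).den) * ((-a₄).num * (-a₄).den)).natAbs with hN
  have hN0 : N ≠ 0 := Int.natAbs_ne_zero.2 (mul_ne_zero (mul_ne_zero (num_mul_den_ne_zero hb₂0)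
    (num_mul_den_ne_zero hb₃0)) (num_mul_den_ne_zero hb₄0))
  set T : Finset ℕ := (2 * N).primeFactors with hT
  have hTp : ∀ p ∈ T, p.Prime := fun p hp ↦ Nat.prime_of_mem_primeFactors hp
  set S : Finset (HeightOneSpectrum (𝓞 ℚ)) :=
    T.attach.image (fun p ↦ (primesEquiv (R := 𝓞 ℚ)).symm ⟨p.1, hTp p.1 p.2⟩) with hS
  have hmemS : ∀ v, v ∈ S ↔ natGenerator v ∈ T := mem_image_primesEquiv_symm_iff T hTp
  have hnotS : ∀ v, v ∉ S → natGenerator v ≠ 2 ∧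
      ¬ ((natGenerator v : ℕ) : ℤ) ∣ (-a₂).num * (-a₂).den ∧ ¬ ((natGenerator v : ℕ) : ℤ) ∣ (-a₃).num * (-a₃).den ∧
        ¬ ((natGenerator v : ℕ) : ℤ) ∣ (-a₄).num * (-a₄).den := by
    intro v hv
    rw [hmemS, hT, Nat.mem_primeFactors, not_and, not_and] at hv
    have hnd : ¬ natGenerator v ∣ 2 * N := fun h ↦ hv (prime_natGenerator v) h (by positivity)
    have hndN : ∀ r : ℤ, r ∣ ((-a₂).num * (-a₂).den) * ((-a₃).num * (-a₃).den) * ((-a₄).num * (-a₄).den) →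
        ¬ ((natGenerator v : ℕ) : ℤ) ∣ r := by
      intro r hr h
      apply hnd
      have : natGenerator v ∣ N := by
        rw [hN]
        exact Int.ofNat_dvd_left.1 (h.trans hr)
      exact this.mul_left 2
    refine ⟨fun h2 ↦ hnd (h2 ▸ dvd_mul_right 2 N), hndN _ ⟨((-a₃).num * (-a₃).den) * ((-a₄).num * (-a₄).den), by ring⟩,
      hndN _ ⟨((-a₂).num * (-a₂).den) * ((-a₄).num * (-a₄).den), by ring⟩,
      hndN _ ⟨((-a₂).num * (-a₂).den) * ((-a₃).num * (-a₃).den), by ring⟩⟩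
  -- local common values of `h` and `g`
  have hloc : ∀ v : HeightOneSpectrum (𝓞 ℚ), ∃ t : v.adicCompletion ℚ, t ≠ 0 ∧
      (∃ y z : v.adicCompletion ℚ, algebraMap ℚ _ a₀ * y ^ 2 + algebraMap ℚ _ a₁ * z ^ 2 = t) ∧
      ∃ p q r : v.adicCompletion ℚ, algebraMap ℚ _ (-a₂) * p ^ 2 + algebraMap ℚ _ (-a₃) * q ^ 2 +
        algebraMap ℚ _ (-a₄) * r ^ 2 = t := fun v ↦
    exists_binary_ternary_common ℚ v ((map_ne_zero _).2 h₀) ((map_ne_zero _).2 h₁)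
      ((map_ne_zero _).2 hb₂0) ((map_ne_zero _).2 hb₃0) ((map_ne_zero _).2 hb₄0)
  choose t ht0 hh hg using hloc
  choose Y Z hYZ using hh
  -- neighbourhoods in `ℚ_v × ℚ_v` (`v ∈ S`) on which `h` stays in the square class of `t v`
  let W : ∀ v : (S : Type), Set (v.1.adicCompletion ℚ × v.1.adicCompletion ℚ) := fun v ↦
    {p | Valued.v (algebraMap ℚ _ a₀ * p.1 ^ 2 + algebraMap ℚ _ a₁ * p.2 ^ 2 - t v.1) <
      Valued.v (4 * t v.1)}
  have hW : ∀ v : (S : Type), W v ∈ 𝓝 (Y v.1, Z v.1) := by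
    intro v
    have hcont : Continuous fun p : v.1.adicCompletion ℚ × v.1.adicCompletion ℚ ↦
        algebraMap ℚ _ a₀ * p.1 ^ 2 + algebraMap ℚ _ a₁ * p.2 ^ 2 := by fun_prop
    have hmem : {x | Valued.v (x - t v.1) < Valued.v (4 * t v.1)} ∈
        𝓝 (algebraMap ℚ _ a₀ * (Y v.1, Z v.1).1 ^ 2 + algebraMap ℚ _ a₁ * (Y v.1, Z v.1).2 ^ 2) := by
      rw [hYZ]
      exact ball_four_mul_mem_nhds v.1 (ht0 v.1)
    exact hcont.continuousAt.preimage_mem_nhds hmem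
  -- the neighbourhood at the real place: the sign `σ`
  let w₀ : InfinitePlace ℚ := default
  have hw₀ : w₀.IsReal := IsTotallyReal.isReal w₀
  let e := InfinitePlace.Completion.ringEquivRealOfIsReal hw₀
  have he : ∀ q : ℚ, e (algebraMap ℚ w₀.Completion q) = (q : ℝ) := fun q ↦ by
    change InfinitePlace.Completion.ringEquivRealOfIsReal hw₀ (algebraMap ℚ w₀.Completion q) = _
    rw [ringEquivRealOfIsReal_algebraMap]
    exact eq_ratCast _ q
  let Wr : Set (w₀.Completion × w₀.Completion) :=
    {p | 0 < (σ : ℝ) * ((a₀ : ℝ) * e p.1 ^ 2 + (a₁ : ℝ) * e p.2 ^ 2)}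
  have hWr : Wr ∈ 𝓝 (algebraMap ℚ w₀.Completion u₀, algebraMap ℚ w₀.Completion u₁) := by
    have he_cont : Continuous e := (InfinitePlace.Completion.isometryEquivRealOfIsReal hw₀).continuous
    have hcont : Continuous fun p : w₀.Completion × w₀.Completion ↦
        (σ : ℝ) * ((a₀ : ℝ) * e p.1 ^ 2 + (a₁ : ℝ) * e p.2 ^ 2) := by fun_prop
    refine (isOpen_lt continuous_const hcont).mem_nhds ?_
    change 0 < (σ : ℝ) * ((a₀ : ℝ) * e (algebraMap ℚ w₀.Completion u₀) ^ 2 +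
      (a₁ : ℝ) * e (algebraMap ℚ w₀.Completion u₁) ^ 2)
    rw [he, he]
    exact_mod_cast hσh
  -- weak approximation for the pair `(x₀, x₁)`
  let f : ℚ → ((v : (S : Type)) → v.1.adicCompletion ℚ) × InfiniteAdeleRing ℚ := fun k ↦
    ((fun v : (S : Type) ↦ algebraMap ℚ (v.1.adicCompletion ℚ) k), algebraMap ℚ (InfiniteAdeleRing ℚ) k)
  have hf : DenseRange f := GaloisRepresentations.denseRange_algebraMap_pi_prod (K := ℚ) S
  have hΦ : DenseRange (Prod.map f f) := hf.prodMap hf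
  let P₀ : ((v : (S : Type)) → v.1.adicCompletion ℚ) × InfiniteAdeleRing ℚ :=
    (fun v ↦ Y v.1, fun w ↦ algebraMap ℚ w.Completion u₀)
  let P₁ : ((v : (S : Type)) → v.1.adicCompletion ℚ) × InfiniteAdeleRing ℚ :=
    (fun v ↦ Z v.1, fun w ↦ algebraMap ℚ w.Completion u₁)
  let M : Set ((((v : (S : Type)) → v.1.adicCompletion ℚ) × InfiniteAdeleRing ℚ) ×
      (((v : (S : Type)) → v.1.adicCompletion ℚ) × InfiniteAdeleRing ℚ)) :=
    (⋂ v : (S : Type), {Q | (Q.1.1 v, Q.2.1 v) ∈ W v}) ∩ {Q | (Q.1.2 w₀, Q.2.2 w₀) ∈ Wr}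
  have hM : M ∈ 𝓝 (P₀, P₁) := by
    refine Filter.inter_mem (Filter.iInter_mem.2 fun v ↦ ?_) ?_
    · have hc : Continuous fun Q : (((v : (S : Type)) → v.1.adicCompletion ℚ) × InfiniteAdeleRing ℚ) ×
          (((v : (S : Type)) → v.1.adicCompletion ℚ) × InfiniteAdeleRing ℚ) ↦ (Q.1.1 v, Q.2.1 v) := by
        fun_prop
      exact hc.continuousAt.preimage_mem_nhds (hW v)
    · have hc : Continuous fun Q : (((v : (S : Type)) → v.1.adicCompletion ℚ) × InfiniteAdeleRing ℚ) ×
          (((v : (S : Type)) → v.1.adicCompletion ℚ) × InfiniteAdeleRing ℚ) ↦ (Q.1.2 w₀, Q.2.2 w₀) := by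
        fun_prop
      exact hc.continuousAt.preimage_mem_nhds hWr
  obtain ⟨_, ⟨⟨y₀, y₁⟩, rfl⟩, hPM⟩ := hΦ.inter_nhds_nonempty hM
  obtain ⟨hPv, hPr⟩ := hPM
  rw [Set.mem_iInter] at hPv
  -- the rational value `a = h(y₀, y₁)`
  set a : ℚ := a₀ * y₀ ^ 2 + a₁ * y₁ ^ 2 with ha_def
  have haσ : 0 < σ * a := by
    have h := hPr
    change 0 < (σ : ℝ) * ((a₀ : ℝ) * e (algebraMap ℚ w₀.Completion y₀) ^ 2 +
      (a₁ : ℝ) * e (algebraMap ℚ w₀.Completion y₁) ^ 2) at h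
    rw [he, he] at h
    exact_mod_cast h
  have ha0 : a ≠ 0 := by
    rintro h0
    rw [h0, mul_zero] at haσ
    exact lt_irrefl _ haσ
  have hsq : ∀ v ∈ S, IsSquare (algebraMap ℚ (v.adicCompletion ℚ) a / t v) := by
    intro v hv
    have h := hPv ⟨v, hv⟩
    change Valued.v (algebraMap ℚ _ a₀ * algebraMap ℚ _ y₀ ^ 2 + algebraMap ℚ _ a₁ * algebraMap ℚ _ y₁ ^ 2 -
      t v) < Valued.v (4 * t v) at h
    refine (isSquare_div_of_valued_sub_lt ℚ v (ht0 v) ?_).1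
    simpa only [ha_def, map_add, map_mul, map_pow] using h
  -- the quaternary form `f₁ = ⟨a, a₂, a₃, a₄⟩` represents `0` in every `ℚ_v`
  have hf₁ : ∀ v : HeightOneSpectrum (𝓞 ℚ), ∃ z : Fin 4 → v.adicCompletion ℚ, z ≠ 0 ∧
      algebraMap ℚ _ a * z 0 ^ 2 + algebraMap ℚ _ a₂ * z 1 ^ 2 + algebraMap ℚ _ a₃ * z 2 ^ 2 +
        algebraMap ℚ _ a₄ * z 3 ^ 2 = 0 := by
    intro v
    by_cases hv : v ∈ S
    · obtain ⟨s, hs⟩ := hsq v hv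
      obtain ⟨p, q, r, hpqr⟩ := hg v
      refine ⟨![1, p * s, q * s, r * s], fun h ↦ one_ne_zero (α := v.adicCompletion ℚ) (by simpa using congrFun h 0), ?_⟩
      simp only [Matrix.cons_val_zero, Matrix.cons_val_one, Matrix.cons_val]
      have ht := ht0 v
      have hat : algebraMap ℚ (v.adicCompletion ℚ) a = t v * (s * s) := by
        rw [← hs]; field_simp
      simp only [map_neg] at hpqr
      rw [hat]
      linear_combination (-(s * s)) * hpqr
    · obtain ⟨hv2, hd₂, hd₃, hd₄⟩ := hnotS v hv
      obtain ⟨p, q, r, hpqr⟩ := exists_ternary_eq_of_units v hv2 hb₂0 hb₃0 hb₄0 ha0 hd₂ hd₃ hd₄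
      refine ⟨![1, p, q, r], fun h ↦ one_ne_zero (α := v.adicCompletion ℚ) (by simpa using congrFun h 0), ?_⟩
      simp only [Matrix.cons_val_zero, Matrix.cons_val_one, Matrix.cons_val]
      simp only [map_neg] at hpqr
      linear_combination (-1 : v.adicCompletion ℚ) * hpqr
  -- `f₁` is indefinite
  have hσg' : σ * a₂ < 0 ∨ σ * a₃ < 0 ∨ σ * a₄ < 0 := hσg
  have hpos₁ : ¬ (0 < a ∧ 0 < a₂ ∧ 0 < a₃ ∧ 0 < a₄) := by
    rintro ⟨ha, h2, h3, h4⟩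
    rcases hσ with rfl | rfl
    · rcases hσg' with h | h | h <;> linarith
    · linarith
  have hneg₁ : ¬ (a < 0 ∧ a₂ < 0 ∧ a₃ < 0 ∧ a₄ < 0) := by
    rintro ⟨ha, h2, h3, h4⟩
    rcases hσ with rfl | rfl
    · linarith
    · rcases hσg' with h | h | h <;> linarith
  obtain ⟨z, hz0, hz⟩ := exists_quaternary_zero_rat ha0 h₂ h₃ h₄ hf₁ hpos₁ hneg₁
  -- assemble the zero of `f`
  by_cases hz00 : z 0 = 0
  · refine ⟨![0, 0, z 1, z 2, z 3], fun h ↦ hz0 ?_, ?_⟩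
    · have h1 : z 1 = 0 := by simpa using congrFun h 2
      have h2 : z 2 = 0 := by simpa using congrFun h 3
      have h3 : z 3 = 0 := by simpa using congrFun h 4
      ext i; fin_cases i <;> simp [hz00, h1, h2, h3]
    · simp only [Matrix.cons_val_zero, Matrix.cons_val_one, Matrix.cons_val]
      rw [hz00] at hz
      linear_combination hz
  · refine ⟨![y₀ * z 0, y₁ * z 0, z 1, z 2, z 3], fun h ↦ ha0 ?_, ?_⟩
    · have hy₀ : y₀ = 0 := by simpa [hz00] using congrFun h 0
      have hy₁ : y₁ = 0 := by simpa [hz00] using congrFun h 1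
      rw [ha_def, hy₀, hy₁]; ring
    · simp only [Matrix.cons_val_zero, Matrix.cons_val_one, Matrix.cons_val]
      rw [ha_def] at hz
      linear_combination hz

end Literature.NumberTheory.QuadraticForms
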